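import Summits.ResolutionOfSingularities.ResolutionOfSingularities.Theorems.PurelyInseparableDim4ResConeSupportConfinedRepresentation
import Summits.ResolutionOfSingularities.ResolutionOfSingularities.Theorems.PurelyInseparableDim4ResConeLightPairAllPrimes
import Summits.ResolutionOfSingularities.ResolutionOfSingularities.Theorems.PurelyInseparableDim4ResConeLightQuadTail
import HarnessLib
import HarnessLib.Audit.Tags

/-!
# Purely inseparable four-folds — THE LIGHT TRIPLE `(1,1,1)` BINARY-CONE TAIL IS EMPTY FOR EVERY PRIME `p`; HENCE THERE IS NO LIGHT
# BINARY-CONE TAIL AT ANY `(p, d)` AND EVERY CONSTANT-SHADE `e_G = 2` TAIL IS EVENTUALLY HEAVY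
# (K2(p) lane, slice C, rung-1 generic kill; the `(5,3)` light-lossy method of res-dim4-p-1 g5 made `p`-generic; seat res-dim4-p-1 g6)

[OURS · counted 0 · cell `res-dim4-pi` · K2(p) lane (holder lineage res-dim4-p-12; rung-1 generic bricks «no `7` in a signature»,
desk WORD #193 (δ)) · seat res-dim4-p-1 g6.]  Nothing here proves K2(p) = `RidgeBudget.NoAboveFloorTrap p p` for any `p ≥ 7`,
any TAIL(7, d, e), `NoIsolatedTrap p p`, the Cossart–Jannsen–Saito theorem or resolution of singularities in dimension ≥ 4 /
characteristic `p` — NOT proved; every theorem is about OUR frame's hypothetical `Step0 p` chains.  AI kernel work, weaker than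
expert review.

THE LIGHT BRANCH OF THE WEIGHT AUTOMATON (res-dim4-p-3 g5's `shadeWeights_dichotomy`, every `(p, d)`): a constant-shade-`d` tail is
either LIGHT for ever — all weights `≤ 1` and `|r_k| + d = p + 1` — or eventually HEAVY (some weight `≥ 2`).  With four letters a light
boundary weighs `|r| ∈ {2, 3, 4}`, i.e. `d ∈ {p − 1, p − 2, p − 3}`: the LIGHT PAIR (res-dim4-p-5 g5 `no_light_pair_tail_prime`, p709143,
every `p`), the LIGHT QUAD (res-dim4-p-3 g5 `no_lightQuad_tail`, p709936, every `p`), and the LIGHT TRIPLE `(1,1,1)` at `(p, p − 2)` —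
killed at `p = 5` only (res-dim4-p-1 g5 `LightRep.no_light_tail_three_five`, p705856; the `(7,5)` light orbit of the holder's SCC census
§2a was open).  This file kills the light triple for EVERY prime and closes the light branch:
* **`no_light_triple_binaryCone_tail (p)`** — no witnessed isolated above-floor `Step0 p` chain with `x^{r₀} ∣ F₀` has, from some `k₀`,
  constant shade `d < p`, `e_G ≡ 2` and a light-triple boundary (weights `≤ 1`, `|r| = 3`).  ROUTE (res-dim4-p-1 g5's «honest loss-free
  re-presentation + C13», now over res-dim4-typ-1 g4's generic transport): `support_representation_of_satellite p`
  (`…ResConeSupportConfinedRepresentation`, this seat) gives an honest partner `c′` confined to `S := supp r_{kₑ}`, `#S = 3`, with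
  weights a renaming of the real ones — so `c′` is a light triple weighing `1` on ALL of `S` at every time
  (`apply_eq_one_of_confined`); a translation of `c′` at a letter of `S` other than the chart would drop that weight to `0`
  (`step_r_univ'`) — impossible — so every translation avoids `S`, i.e. `c′` is LOSS-FREE, and res-dim4-p-5 g3's C13
  `no_lossfree_tail p` ends it.
* **`no_light_binaryCone_tail (p)`** — NO light binary-cone tail at any `(p, d)`, `d < p`: by `|r| ∈ {2, 3, 4}` one of the three kills.
* **`binaryCone_eventually_heavy (p)`** — every constant-shade-`d < p`, `e_G ≡ 2` tail has, from some `k₁ ≥ k₀` on, a boundary letter of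
  weight `≥ 2` at every time (`shadeWeights_dichotomy` + the above); the all-`d` form of p-3's
  `binaryCone_eventually_heavy_of_add_three_le` (`d + 3 ≤ p`) and p-5's `eventually_heavy_prime` (`d + 1 = p`).
[cite: CossartJannsenSaito2020, Thm. 3.10(4), Thm. 3.14, Thm. 9.3, Lemma 13.2, Thm. 13.7] [cite: Hauser2010, §§F–G (chart expressions of a point blowup; cleaning)]
bears_on: LADDER-RESOLUTION:D157-DOOR2 (res-dim4-pi · K2(p) = `RidgeBudget.NoAboveFloorTrap p p` · slice C · rung-1 generic: light
triple dead ∀ p, every `e_G = 2` tail eventually heavy).  Supports stmt-ResolutionOfSingularities-16155 (helper).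
-/

set_option linter.dupNamespace false -- mandated namespace of this single-conjunct summit

noncomputable section

namespace Summit.ResolutionOfSingularities.ResolutionOfSingularities.Theorems.PIDim4

namespace ResCone

open MvPolynomial Finset
open Literature.AlgebraicGeometry.Resolution
open Literature.AlgebraicGeometry.Resolution.CentreBlowup
open Literature.AlgebraicGeometry.Resolution.Hauser2010
open Literature.AlgebraicGeometry.Resolution.HauserPerlega2019

variable {K : Type} [Field K] [DecidableEq K] (p : ℕ) [Fact p.Prime] [CharP K p]

/-- **THE LIGHT TRIPLE `(1,1,1)` BINARY-CONE TAIL IS EMPTY, FOR EVERY PRIME `p`.**  Over a field of characteristic `p`, no witnessed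
isolated above-floor `Step0 p` chain with `x^{r₀} ∣ F₀` has, from some `k₀` on, constant shade `d < p`, `e_G ≡ 2`, and a light-triple
boundary (all weights `≤ 1`, `|r| = 3`; the weight law then forces `d = p − 2`).  Route: `support_representation_of_satellite` → the
`S`-confined partner weighs `1` on all of `S` (`#S = 3`) for ever → loss-free → C13 `no_lossfree_tail`. [OURS]
[cite: CossartJannsenSaito2020, Thm. 3.10(4), Thm. 3.14, Thm. 9.3, Lemma 13.2, Thm. 13.7] [cite: Hauser2010, §§F–G (chart expressions of a point blowup; cleaning)] -/
theorem no_light_triple_binaryCone_tail {c : ℕ → State K} {j : ℕ → Fin 4} {b : ℕ → Fin 4 → K}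
    (hc : ∀ k, IsIsolated p (c k).F ∧ Step0 p (c k) (c (k + 1))) (hw : FreeTail.IsWitnessedChain p c j b)
    (hr0 : ∀ e ∈ (c 0).F.support, (c 0).r ≤ e) (hfloor : ∀ k, ordZero (c k).F ≠ p) {k₀ d : ℕ} (hdp : d < p)
    (hshade : ∀ k, k₀ ≤ k → (c k).shade = (d : ℕ∞)) (he : ∀ k, k₀ ≤ k → Module.finrank K (resVertex (c k)) = 2)
    (hlight : ∀ k, k₀ ≤ k → (∀ i, (c k).r i ≤ 1) ∧ (c k).r.degree = 3) : False := by
  -- (1) the support-confined honest partner from a late satellite time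
  obtain ⟨kₑ, c', j', b', hke, h0, hperm, hconf, -, -, hc', hw', hr0', hfloor', hshade', he'⟩ :=
    support_representation_of_satellite p hc hw hr0 hfloor hshade he (le_refl k₀)
  set S : Finset (Fin 4) := (c kₑ).r.support with hS
  have hstep' : ∀ t, c' (t + 1) = CentreBlowup.step p Finset.univ (j' t) (b' t) (c' t) := fun t => (hw' t).2.2.2.2
  -- (2) the partner is a light triple weighing `1` on all of `S`
  have hcardS : S.card = 3 := by
    rw [hS, ← degree_eq_card_support_of_le_one (hlight kₑ hke).1]
    exact (hlight kₑ hke).2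
  have hlight' : ∀ t, (∀ i, (c' t).r i ≤ 1) ∧ (c' t).r.degree = 3 := by
    intro t
    obtain ⟨π, hr⟩ := hperm t
    have hw3 := hlight (kₑ + t) (by omega)
    refine ⟨fun i => ?_, ?_⟩
    · rw [hr, Finsupp.mapDomain_equiv_apply, Equiv.symm_symm]; exact hw3.1 _
    · rw [hr, Finsupp.degree_mapDomain]; exact hw3.2
  have hone' : ∀ t, ∀ i ∈ S, (c' t).r i = 1 := fun t i hi =>
    apply_eq_one_of_confined (hlight' t).1 (hconf t) (by rw [(hlight' t).2, hcardS]) hi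
  -- (3) hence loss-free: a translated letter of `S` would weigh `0` in the child
  have hloss : ∀ t, 0 ≤ t → ∀ i, b' t i ≠ 0 → (c' t).r i = 0 := by
    intro t _ i hbi
    by_contra hri
    have hiS : i ∈ S := by
      by_contra hiS
      exact hri (hconf t i hiS)
    have hiℓ : i ≠ j' t := fun h => hbi (by rw [h]; exact (hw' t).2.1)
    obtain ⟨o, ho, -, -⟩ := chain_band p hc' hfloor' t
    have h1 := hone' (t + 1) i hiS
    rw [hstep' t, step_r_univ' p (j' t) (b' t) (c' t) ho, Finsupp.coe_update, Function.update_of_ne hiℓ,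
      Finsupp.filter_apply, if_neg hbi] at h1
    exact zero_ne_one h1
  -- (4) C13
  exact no_lossfree_tail p hc' hw' hr0' hfloor' hdp (k₀ := 0) hshade' he' hloss

/-- **NO LIGHT BINARY-CONE TAIL AT ANY `(p, d)`, every prime `p`.**  On a witnessed isolated above-floor `Step0 p` chain with
`x^{r₀} ∣ F₀`, constant shade `d < p` and `e_G ≡ 2` from `k₀`, the weights cannot stay `≤ 1` for ever: a light boundary weighs
`|r| = p + 1 − d ∈ {2, 3, 4}` (`shadeWeights_dichotomy`, `degree_le_four_of_forall_le_one`) and the light pair (res-dim4-p-5 g5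
`no_light_pair_tail_prime`), the light triple (`no_light_triple_binaryCone_tail`) and the light quad (res-dim4-p-3 g5 `no_lightQuad_tail`)
are all dead. [OURS] [cite: CossartJannsenSaito2020, Thm. 3.10(4), Thm. 3.14, Thm. 9.3, Lemma 13.2, Thm. 13.7] -/
theorem no_light_binaryCone_tail {c : ℕ → State K} {j : ℕ → Fin 4} {b : ℕ → Fin 4 → K}
    (hc : ∀ k, IsIsolated p (c k).F ∧ Step0 p (c k) (c (k + 1))) (hw : FreeTail.IsWitnessedChain p c j b)
    (hr0 : ∀ e ∈ (c 0).F.support, (c 0).r ≤ e) (hfloor : ∀ k, ordZero (c k).F ≠ p) {k₀ d : ℕ} (hdp : d < p)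
    (hshade : ∀ k, k₀ ≤ k → (c k).shade = (d : ℕ∞)) (he : ∀ k, k₀ ≤ k → Module.finrank K (resVertex (c k)) = 2)
    (hlight : ∀ k, k₀ ≤ k → ∀ i, (c k).r i ≤ 1) : False := by
  -- the light branch of the dichotomy: `|r_k| + d = p + 1`
  have hsum : ∀ k, k₀ ≤ k → (c k).r.degree + d = p + 1 := by
    rcases shadeWeights_dichotomy p hc hw hr0 hfloor hshade with hL | ⟨k₁, hk₁, hH⟩
    · exact fun k hk => (hL k hk).2
    · obtain ⟨W, hW⟩ := hH k₁ le_rfl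
      have := hlight k₁ hk₁ W
      omega
  have h4 : (c k₀).r.degree ≤ 4 := degree_le_four_of_forall_le_one (hlight k₀ le_rfl)
  have hk₀ := hsum k₀ le_rfl
  -- `|r| ∈ {2, 3, 4}` according to `d = p − 1, p − 2, p − 3`
  rcases Nat.lt_or_ge (d + 2) p with hlt | hge
  · rcases Nat.lt_or_ge (d + 3) p with hlt' | hge'
    · omega
    · -- `d + 3 = p`: the light quad
      exact no_lightQuad_tail p hc hw hr0 hfloor hshade (by omega) he fun k hk => ⟨hlight k hk, hsum k hk⟩
  · rcases Nat.lt_or_ge (d + 1) p with hlt' | hge'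
    · -- `d + 2 = p`: the light triple
      exact no_light_triple_binaryCone_tail p hc hw hr0 hfloor hdp hshade he fun k hk =>
        ⟨hlight k hk, by have := hsum k hk; omega⟩
    · -- `d + 1 = p`: the light pair
      exact no_light_pair_tail_prime p hc hw hr0 hfloor hdp hshade he fun k hk =>
        ⟨hlight k hk, by have := hsum k hk; omega⟩

/-- **EVERY CONSTANT-SHADE `e_G = 2` TAIL IS EVENTUALLY HEAVY, every prime `p`, every shade `d < p`.**  On a witnessed isolated
above-floor `Step0 p` chain with `x^{r₀} ∣ F₀`, constant shade `d < p` and `e_G ≡ 2` from `k₀`, from some `k₁ ≥ k₀` on every state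
has a boundary letter of weight `≥ 2` (`shadeWeights_dichotomy`, the light branch being empty by `no_light_binaryCone_tail`).  The
all-`d` form of res-dim4-p-3 g5's `binaryCone_eventually_heavy_of_add_three_le` (`d + 3 ≤ p`) and res-dim4-p-5 g5's
`eventually_heavy_prime` (`d + 1 = p`); the new case is `d + 2 = p`. [OURS]
[cite: CossartJannsenSaito2020, Thm. 3.10(4), Thm. 3.14, Thm. 9.3, Lemma 13.2, Thm. 13.7] -/
theorem binaryCone_eventually_heavy {c : ℕ → State K} {j : ℕ → Fin 4} {b : ℕ → Fin 4 → K}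
    (hc : ∀ k, IsIsolated p (c k).F ∧ Step0 p (c k) (c (k + 1))) (hw : FreeTail.IsWitnessedChain p c j b)
    (hr0 : ∀ e ∈ (c 0).F.support, (c 0).r ≤ e) (hfloor : ∀ k, ordZero (c k).F ≠ p) {k₀ d : ℕ} (hdp : d < p)
    (hshade : ∀ k, k₀ ≤ k → (c k).shade = (d : ℕ∞)) (he : ∀ k, k₀ ≤ k → Module.finrank K (resVertex (c k)) = 2) :
    ∃ k₁, k₀ ≤ k₁ ∧ ∀ k, k₁ ≤ k → ∃ W, 2 ≤ (c k).r W := by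
  rcases shadeWeights_dichotomy p hc hw hr0 hfloor hshade with hL | hH
  · exact (no_light_binaryCone_tail p hc hw hr0 hfloor hdp hshade he fun k hk => (hL k hk).1).elim
  · exact hH

omit [CharP K p] in
/-- **THE LIGHT TRIPLE FORCES `d = p − 2`** (bookkeeping, recorded for the census reading): a light-triple constant-shade-`d` tail has
`3 + d = p + 1`. [OURS] [folklore] -/
theorem light_triple_shade_eq {c : ℕ → State K} {j : ℕ → Fin 4} {b : ℕ → Fin 4 → K}
    (hc : ∀ k, IsIsolated p (c k).F ∧ Step0 p (c k) (c (k + 1))) (hw : FreeTail.IsWitnessedChain p c j b)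
    (hr0 : ∀ e ∈ (c 0).F.support, (c 0).r ≤ e) (hfloor : ∀ k, ordZero (c k).F ≠ p) {k₀ d : ℕ}
    (hshade : ∀ k, k₀ ≤ k → (c k).shade = (d : ℕ∞))
    (hlight : ∀ k, k₀ ≤ k → (∀ i, (c k).r i ≤ 1) ∧ (c k).r.degree = 3) : d + 2 = p := by
  rcases shadeWeights_dichotomy p hc hw hr0 hfloor hshade with hL | ⟨k₁, hk₁, hH⟩
  · have h := (hL k₀ le_rfl).2
    rw [(hlight k₀ le_rfl).2] at h
    omega
  · obtain ⟨W, hW⟩ := hH k₁ le_rfl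
    have := (hlight k₁ hk₁).1 W
    omega

end ResCone

end Summit.ResolutionOfSingularities.ResolutionOfSingularities.Theorems.PIDim4

end
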